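import Summits.ValiantsHypothesis.ValiantsHypothesis.Theorems.BarrierLeverPartitionMinorsHitByVPExactCoverDoor

/-!
# Route BarrierLever — item `PartitionMinorsHitByVP` (stmt-ValiantsHypothesis-19717):
# brick calculus — rows of `f · (1 + x^Z y^W)` for an arbitrary polynomial `f`

Helper file (`--supports stmt-ValiantsHypothesis-19717`; cell valiant-natproofs, rung V4, 𝒟-side door (c);
prover seat val-np-p1 gen 14). Closes NO item. Route-independent coefficient calculus used by the
cube-versus-Hamming-ball theorem (`…CubeBallRows`, `…CubeBall`) and by any argument that multiplies a witness by
weight-one BRICK factors `1 + x^Z y^W` (`ExactCoverDoor`, p556909).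

* `pexpo U W` — the exponent of the square-free monomial `x^U y^W` read by item 19717's layout matrix
  (`x_a = X (castAdd h a)`, `y_c = X (natAdd h c)`), with `pexpo_le_iff` (divisibility = containment) and `pexpo_sub`;
* `brick Z W = 1 + C 1 · ∏_{a∈Z} x_a · ∏_{c∈W} y_c` (the shape of `ExactCoverDoor.complexity_brick_le`) and
  `brick_eq : brick Z W = 1 + monomial (pexpo Z W) 1`;
* **`coeff_pexpo_mul_brick`** — for EVERY polynomial `f`:
  `coeff_{x^U y^W'} (f · brick Z W) = coeff_{x^U y^W'} f + [Z ⊆ U][W ⊆ W'] · coeff_{x^{U∖Z} y^{W'∖W}} f`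
  (generalises `DownCompression.coeff_partitionExpo_mul_one_add_x/_y`, the cases `|Z|+|W| = 1`);
* **`coeff_pexpo_mul_prod_brick`** — a FAN `∏_{d∈D} (1 + x^Z y_d)` with common nonempty `x`-part acts as
  `coeff_{x^U y^W} ↦ coeff_{x^U y^W} + [Z ⊆ U] Σ_{d ∈ D∩W} coeff_{x^{U∖Z} y^{W∖d}}` (in the zeon algebra the fan is
  `1 + x^Z · Σ_{d∈D} y_d`, a LINEAR form attached to `x^Z` — the Lefschetz element of `…CubeBall`);
* variable support: `coeff_pexpo_eq_zero_of_vars`, `vars_brick_subset`, `vars_mul_brick_subset`,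
  `vars_mul_prod_brick_subset`.

WHAT THIS IS NOT: no statement about item 19717 itself; nothing on crux stmt-ValiantsHypothesis-14610 or `VP` versus `VNP`.
-/

set_option linter.dupNamespace false

namespace Summit.ValiantsHypothesis.ValiantsHypothesis.Theorems.BarrierLever.BrickCalculus

open Finset MvPolynomial
open Literature.Computability.AlgebraicComplexity
open Summit.ValiantsHypothesis.ValiantsHypothesis.Theorems.BarrierLever.ProductStateSums
  (castAdd_ne_natAdd partitionExpo_apply_castAdd partitionExpo_apply_natAdd)

noncomputable section

variable {h : ℕ}

/-! ## 1. Partition exponents and one brick factor -/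

/-- The exponent vector of the square-free monomial `x^U y^W` (`x_a = X (castAdd h a)`, `y_c = X (natAdd h c)`);
this is literally the exponent read by item 19717's layout matrix. -/
def pexpo (U W : Finset (Fin h)) : Fin (h + h) →₀ ℕ :=
  ∑ a ∈ U, Finsupp.single (Fin.castAdd h a) 1 + ∑ c ∈ W, Finsupp.single (Fin.natAdd h c) 1

/-- Unfolding `pexpo`. -/
theorem pexpo_def (U W : Finset (Fin h)) : pexpo U W =
    ∑ a ∈ U, Finsupp.single (Fin.castAdd h a) 1 + ∑ c ∈ W, Finsupp.single (Fin.natAdd h c) 1 := rfl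

/-- The `x_a`-exponent of `x^U y^W` is `[a ∈ U]`. -/
theorem pexpo_apply_castAdd (U W : Finset (Fin h)) (a : Fin h) :
    pexpo U W (Fin.castAdd h a) = if a ∈ U then 1 else 0 :=
  partitionExpo_apply_castAdd U W a

/-- The `y_c`-exponent of `x^U y^W` is `[c ∈ W]`. -/
theorem pexpo_apply_natAdd (U W : Finset (Fin h)) (c : Fin h) :
    pexpo U W (Fin.natAdd h c) = if c ∈ W then 1 else 0 :=
  partitionExpo_apply_natAdd U W c

/-- `x^Z y^W` divides `x^U y^W'` iff `Z ⊆ U` and `W ⊆ W'`. -/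
theorem pexpo_le_iff (Z W U W' : Finset (Fin h)) : pexpo Z W ≤ pexpo U W' ↔ Z ⊆ U ∧ W ⊆ W' := by
  constructor
  · intro hle
    refine ⟨fun a ha => ?_, fun c hc => ?_⟩
    · have h1 := hle (Fin.castAdd h a)
      rw [pexpo_apply_castAdd, pexpo_apply_castAdd, if_pos ha] at h1
      by_contra hU; rw [if_neg hU] at h1; exact Nat.not_succ_le_zero 0 h1
    · have h1 := hle (Fin.natAdd h c)
      rw [pexpo_apply_natAdd, pexpo_apply_natAdd, if_pos hc] at h1
      by_contra hU; rw [if_neg hU] at h1; exact Nat.not_succ_le_zero 0 h1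
  · rintro ⟨hZ, hW⟩ i
    refine Fin.addCases (fun a => ?_) (fun c => ?_) i
    · rw [pexpo_apply_castAdd, pexpo_apply_castAdd]
      by_cases ha : a ∈ Z
      · rw [if_pos ha, if_pos (hZ ha)]
      · rw [if_neg ha]; exact Nat.zero_le _
    · rw [pexpo_apply_natAdd, pexpo_apply_natAdd]
      by_cases hc : c ∈ W
      · rw [if_pos hc, if_pos (hW hc)]
      · rw [if_neg hc]; exact Nat.zero_le _

/-- `x^U y^W' / x^Z y^W = x^{U∖Z} y^{W'∖W}` on exponents. -/
theorem pexpo_sub (Z W U W' : Finset (Fin h)) (hZ : Z ⊆ U) (hW : W ⊆ W') :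
    pexpo U W' - pexpo Z W = pexpo (U \ Z) (W' \ W) := by
  ext i
  rw [Finsupp.tsub_apply]
  refine Fin.addCases (fun a => ?_) (fun c => ?_) i
  · rw [pexpo_apply_castAdd, pexpo_apply_castAdd, pexpo_apply_castAdd]
    by_cases haZ : a ∈ Z
    · simp [hZ haZ, haZ, Finset.mem_sdiff]
    · by_cases haU : a ∈ U <;> simp [haU, haZ, Finset.mem_sdiff]
  · rw [pexpo_apply_natAdd, pexpo_apply_natAdd, pexpo_apply_natAdd]
    by_cases hcZ : c ∈ W
    · simp [hW hcZ, hcZ, Finset.mem_sdiff]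
    · by_cases hcU : c ∈ W' <;> simp [hcU, hcZ, Finset.mem_sdiff]

/-- A product of distinct variables is the monomial of the sum of their unit exponents. -/
theorem prod_X_eq_monomial {ι : Type*} (s : Finset ι) (e : ι → Fin (h + h)) :
    (∏ i ∈ s, X (e i) : MvPolynomial (Fin (h + h)) ℂ) = monomial (∑ i ∈ s, Finsupp.single (e i) 1) 1 := by
  classical
  induction s using Finset.induction_on with
  | empty => simp
  | insert i s hi ih =>
    rw [Finset.prod_insert hi, Finset.sum_insert hi, ih, X, monomial_mul, one_mul]

/-- The weight-one brick factor `1 + x^Z y^W`, in the shape used by `ExactCoverDoor.complexity_brick_le`. -/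
def brick (Z W : Finset (Fin h)) : MvPolynomial (Fin (h + h)) ℂ :=
  1 + C 1 * (∏ a ∈ Z, X (Fin.castAdd h a)) * (∏ c ∈ W, X (Fin.natAdd h c))

/-- `brick Z W = 1 + x^Z y^W` as a monomial. -/
theorem brick_eq (Z W : Finset (Fin h)) : brick Z W = 1 + monomial (pexpo Z W) 1 := by
  rw [brick, C_1, one_mul, prod_X_eq_monomial, prod_X_eq_monomial, monomial_mul, one_mul, pexpo]

/-- Size of one brick factor: `≤ 2h + 3` (`ExactCoverDoor.complexity_brick_le`). -/
theorem complexity_brick_le' (Z W : Finset (Fin h)) : complexity (brick Z W) ≤ 2 * h + 3 :=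
  ExactCoverDoor.complexity_brick_le 1 Z W

/-- **Row rule for one brick, for EVERY polynomial `f`.**
`coeff_{x^U y^W'} (f · (1 + x^Z y^W)) = coeff_{x^U y^W'} f + [Z ⊆ U][W ⊆ W'] · coeff_{x^{U∖Z} y^{W'∖W}} f`. -/
theorem coeff_pexpo_mul_brick (f : MvPolynomial (Fin (h + h)) ℂ) (Z W U W' : Finset (Fin h)) :
    coeff (pexpo U W') (f * brick Z W) =
      coeff (pexpo U W') f + if Z ⊆ U ∧ W ⊆ W' then coeff (pexpo (U \ Z) (W' \ W)) f else 0 := by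
  classical
  rw [brick_eq, mul_add, mul_one, coeff_add, coeff_mul_monomial', mul_one]
  congr 1
  by_cases hZW : Z ⊆ U ∧ W ⊆ W'
  · rw [if_pos ((pexpo_le_iff Z W U W').mpr hZW), if_pos hZW, pexpo_sub Z W U W' hZW.1 hZW.2]
  · rw [if_neg (fun hle => hZW ((pexpo_le_iff Z W U W').mp hle)), if_neg hZW]

/-! ## 2. Variable support -/

/-- The support of the exponent `x^U y^W` consists of the `x_a`, `a ∈ U`, and the `y_c`, `c ∈ W`. -/
theorem support_pexpo_subset (U W : Finset (Fin h)) :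
    (pexpo U W).support ⊆ U.image (Fin.castAdd h) ∪ W.image (Fin.natAdd h) := by
  classical
  intro i hi
  rw [Finsupp.mem_support_iff] at hi
  rw [Finset.mem_union, Finset.mem_image, Finset.mem_image]
  revert hi
  refine Fin.addCases (fun a => ?_) (fun c => ?_) i
  · intro hi; rw [pexpo_apply_castAdd] at hi
    by_cases ha : a ∈ U
    · exact Or.inl ⟨a, ha, rfl⟩
    · rw [if_neg ha] at hi; exact absurd rfl hi
  · intro hi; rw [pexpo_apply_natAdd] at hi
    by_cases hc : c ∈ W
    · exact Or.inr ⟨c, hc, rfl⟩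
    · rw [if_neg hc] at hi; exact absurd rfl hi

/-- If every variable of `f` is an `x_a` with `a ∈ A` or a `y_c` with `c ∈ B`, then `coeff_{x^U y^W} f = 0` unless
`U ⊆ A` and `W ⊆ B`. -/
theorem coeff_pexpo_eq_zero_of_vars (f : MvPolynomial (Fin (h + h)) ℂ) (A B : Finset (Fin h))
    (hf : f.vars ⊆ A.image (Fin.castAdd h) ∪ B.image (Fin.natAdd h)) (U W : Finset (Fin h))
    (hUW : ¬ (U ⊆ A ∧ W ⊆ B)) : coeff (pexpo U W) f = 0 := by
  classical
  by_contra hne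
  have hsupp : pexpo U W ∈ f.support := mem_support_iff.mpr hne
  have key : ∀ i, i ∈ (pexpo U W).support → i ∈ f.vars := fun i hi =>
    (mem_vars_iff_mem_support i).mpr ⟨pexpo U W, hsupp, hi⟩
  apply hUW
  refine ⟨fun a ha => ?_, fun c hc => ?_⟩
  · have hi : Fin.castAdd h a ∈ (pexpo U W).support := by
      rw [Finsupp.mem_support_iff, pexpo_apply_castAdd, if_pos ha]; exact one_ne_zero
    have := hf (key _ hi)
    rw [Finset.mem_union, Finset.mem_image, Finset.mem_image] at this
    rcases this with ⟨a', ha', hEq⟩ | ⟨c, _, hEq⟩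
    · rwa [← Fin.castAdd_inj.mp hEq]
    · exact absurd hEq.symm (castAdd_ne_natAdd a c)
  · have hi : Fin.natAdd h c ∈ (pexpo U W).support := by
      rw [Finsupp.mem_support_iff, pexpo_apply_natAdd, if_pos hc]; exact one_ne_zero
    have := hf (key _ hi)
    rw [Finset.mem_union, Finset.mem_image, Finset.mem_image] at this
    rcases this with ⟨a, _, hEq⟩ | ⟨c', hc', hEq⟩
    · exact absurd hEq (castAdd_ne_natAdd a c)
    · rwa [← (Fin.natAdd_inj h).mp hEq]

/-- Variables of a brick factor. -/
theorem vars_brick_subset (Z W : Finset (Fin h)) :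
    (brick Z W).vars ⊆ Z.image (Fin.castAdd h) ∪ W.image (Fin.natAdd h) := by
  classical
  rw [brick_eq]
  refine (vars_add_subset _ _).trans (Finset.union_subset ?_ ?_)
  · rw [vars_one]; exact Finset.empty_subset _
  · rw [vars_monomial one_ne_zero]; exact support_pexpo_subset Z W

/-- Variables of a product with a brick factor. -/
theorem vars_mul_brick_subset (f : MvPolynomial (Fin (h + h)) ℂ) (A B Z W : Finset (Fin h))
    (hf : f.vars ⊆ A.image (Fin.castAdd h) ∪ B.image (Fin.natAdd h)) (hZ : Z ⊆ A) (hW : W ⊆ B) :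
    (f * brick Z W).vars ⊆ A.image (Fin.castAdd h) ∪ B.image (Fin.natAdd h) := by
  classical
  refine (vars_mul f (brick Z W)).trans (Finset.union_subset hf ((vars_brick_subset Z W).trans ?_))
  exact Finset.union_subset_union (Finset.image_subset_image hZ) (Finset.image_subset_image hW)

/-- **Row rule for a fan of bricks `∏_{d ∈ D} (1 + x^Z y_d)` with a common nonempty `x`-part**, any `g`:
`coeff_{x^U y^W} (g · ∏_{d∈D} (1 + x^Z y_d)) = coeff_{x^U y^W} g + [Z ⊆ U] Σ_{d ∈ D ∩ W} coeff_{x^{U∖Z} y^{W∖d}} g`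
(in the zeon algebra the fan is `1 + x^Z Σ_{d∈D} y_d`). -/
theorem coeff_pexpo_mul_prod_brick (g : MvPolynomial (Fin (h + h)) ℂ) (Z : Finset (Fin h)) (hZ : Z.Nonempty)
    (D : Finset (Fin h)) (U W : Finset (Fin h)) :
    coeff (pexpo U W) (g * ∏ d ∈ D, brick Z {d}) = coeff (pexpo U W) g +
      if Z ⊆ U then ∑ d ∈ D.filter (· ∈ W), coeff (pexpo (U \ Z) (W.erase d)) g else 0 := by
  classical
  induction D using Finset.induction_on generalizing U W with
  | empty => simp
  | insert d₀ D hd₀ ih =>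
    rw [Finset.prod_insert hd₀, ← mul_assoc, mul_right_comm, coeff_pexpo_mul_brick, ih, ih]
    have hZU : ¬ Z ⊆ U \ Z := fun hsub => by
      obtain ⟨z, hz⟩ := hZ
      exact (Finset.mem_sdiff.mp (hsub hz)).2 hz
    rw [if_neg hZU, add_zero]
    by_cases hZU' : Z ⊆ U
    · rw [if_pos hZU', if_pos hZU', Finset.filter_insert]
      by_cases hdW : d₀ ∈ W
      · rw [if_pos ⟨hZU', Finset.singleton_subset_iff.mpr hdW⟩, if_pos hdW,
          Finset.sum_insert (fun hmem => hd₀ (Finset.mem_filter.mp hmem).1), Finset.sdiff_singleton_eq_erase]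
        ring
      · rw [if_neg (fun hc => hdW (Finset.singleton_subset_iff.mp hc.2)), if_neg hdW, add_zero]
    · rw [if_neg hZU', if_neg hZU', if_neg (fun hc => hZU' hc.1), add_zero]

end

end Summit.ValiantsHypothesis.ValiantsHypothesis.Theorems.BarrierLever.BrickCalculus
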